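import Mathlib.Data.Fin.VecNotation
import Mathlib.Data.List.FinRange
import Mathlib.Tactic.NormNum
import HarnessLib

/-!
# Camia–Jiang–Newman 2023, §3: the signed graph-partition counts `R(𝒢)` — two small instances
# on which the printed reduction (eq. (31) and Prop. 2, eq. (30)) fails

Topic `Literature/Probability/LatticeModels`; companion of `UrsellMonotonicity.lean` (named fact
`CamiaJiangNewman2023_thm1`, CJN Thm 1) — a CAVEAT for anyone formalising the printed proof.

CJN prove Thm 1 by writing `(Z/2^{|V|})^{k+1} ∂u_{2k}/∂J_{u₀v₀} = Σ_m w(m) R(m)` (Lemma 2) and showing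
`(-1)^{k-1} R(m) ≥ 0` for every current `m` (Prop. 1).  Prop. 1 is reduced (§3.1, eq. (27)) to the
signed count `R(𝒢) = Σ_𝒯 (-1)^{n(𝒯)-1} (n(𝒯)-1)!` over the "partitions" `𝒯` of the multigraph `𝒢`
of `m` into `k+1` subgraphs (§3.1), and Prop. 1 is then deduced from the stronger Prop. 2: for
every list of pairs of edges containing no self-loop and no `u₀v₀`-edge, the RESTRICTED count
(pairs forced into different subgraphs) also satisfies `(-1)^{k-1} R(𝒢; {e,e'}, …) ≥ 0`
(eq. (30)), proved by induction on `|ℰ|` using the contraction identity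
`R(𝒢; [e₁,e₂]) = R(𝒢~)` (eq. (31), "obvious").

This file implements the count of §3.1 verbatim for finite multigraphs (computably) and records,
by kernel evaluation (`decide`), two instances:

* `cjn_eq31_instance` (`k = 1`): `R(𝒢; [e₁,e₂]) = 0` but `R(𝒢~) = 1` — eq. (31) fails, because
  contracting two edges at `v` does not preserve the side condition
  "`u₀ ↮ v₀` in `ℰ_{n(𝒯)} ∪ ℰ_{n(𝒯)+1}`" when a `u₀–v₀` path passes through `v` using exactly one of
  `e₁, e₂`;
* `cjn_eq30_instance` (`k = 2`): for a loop-free list of three pairs of adjacent edges, none of them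
  a `u₀v₀`-edge, `R(𝒢; L) = +1` although `(-1)^{k-1} = -1` — eq. (30), i.e. Prop. 2 as printed,
  fails; the unrestricted count of the same graph is `R(𝒢) = -4`, of the sign Prop. 1 predicts;
* `cjn_eq32_instance`: on that instance the split (32) at the parallel pair `{e₀,e₁}` leaves the
  single term `R(𝒢;[e₀,e₁],L) = R(𝒢~; L~) = +1` whose revised list contains the SELF-LOOP `e₀₁`
  (contraction (31) of two parallel edges) — outside the hypothesis of (30): this is the step where
  the induction of §3.2 leaves its own hypothesis class;
* `shlosman_thm3_instance`: the template of §3, Theorem 3 of Shlosman 1986 (restricted counts for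
  "an arbitrary sequence of pairs of bonds", `k` subgraphs, no special block), fails likewise on a
  loop-free multigraph with a list of adjacent pairs (`k = 2`), by the same parallel-pair mechanism.

So the printed proof of Prop. 1 (hence of Thm 1) has a gap at §3.2; Prop. 1 / Thm 1 themselves are
NOT refuted (they hold in every instance evaluated by brute force: ~10⁴ random multigraphs,
`k ≤ 3`; note that Lemma 2, Lemma 3, §3.1 and §3.3 are not affected — only the induction of §3.2).
Nothing here is a named fact; all statements are closed computations.

ENCODING (faithful to CJN §3.1 for the instances used, where `n(𝒯) ≤ k ≤ 2`).  A partition `𝒯` of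
`𝒢` with `n = n(𝒯)` blocks is a family `Γ₁,…,Γ_{k+1}` of edge-disjoint spanning subgraphs covering
`ℰ`, an even-block set partition `P₁,…,P_n` of the sources `{j}`, with `∂Γ_i = P_i (i < n)`,
`∂Γ_n = P_n Δ {u₀,v₀}`, `∂Γ_i = ∅ (i > n)`, and `u₀ ↮ v₀` in `Γ_n ∪ Γ_{n+1}`; two partitions are the
same iff they have the same SET `{∂Γ₁,…,∂Γ_n}`, the same subgraph for each such boundary, and the
same ordered tuple `(Γ_{n+1},…,Γ_{k+1})`.  We encode `𝒯` as a colouring `c : ℰ → {0,…,k}` (edge `e`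
lies in `Γ_{c(e)+1}`) together with `n`: colours `0..n-2` are the non-special blocks, colour `n-1`
the special block, colours `≥ n` the sourceless tuple.  A partition with `n` blocks corresponds to
exactly `(n-1)!` colourings (the orderings of its non-special blocks), so
`Σ_𝒯 (-1)^{n-1}(n-1)! = Σ_{(c,n) valid} (-1)^{n-1}`; for `n ≤ 2` the correspondence is even a
bijection.  In the instances `u₀, v₀ ∉ {j}`, so `P_n Δ {u₀,v₀} = P_n ∪ {u₀,v₀}`.

## References

* [Shlosman1986] S. B. Shlosman, *Signs of the Ising model Ursell functions*, Comm. Math. Phys. 102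
  (1986) 679–686, §3: partitions of a graph, eq. (15), Theorems 2–3, eqs. (16)–(19).  Read via
  `lit read doi:10.1007/BF01221652`, pp. 4–8.
* [CamiaJiangNewman2023] F. Camia, J. Jiang, C. M. Newman, *Monotonicity of Ursell functions in the
  Ising model*, Comm. Math. Phys. 401 (2023), arXiv:2207.12247: §3.1 (partitions of `𝒢`, eq. (26),
  (27)), §3.2 Prop. 2 (eq. (29)–(32)), Remark 3.  Read via `lit read arxiv:2207.12247`, chunks
  p0007–p0009.
-/

namespace Literature.Probability.LatticeModels

namespace CJNPartitionCount

/-- A finite multigraph on vertex set `Fin nV` with `nE` labelled edges, given by the two endpoint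
maps (self-loops = `fst e = snd e`; parallel edges allowed). [cite: CamiaJiangNewman2023, §3.1] -/
structure MGraph (nV nE : ℕ) where
  /-- first endpoint of each labelled edge -/
  fst : Fin nE → Fin nV
  /-- second endpoint of each labelled edge -/
  snd : Fin nE → Fin nV

variable {nV nE : ℕ}

/-- Number of edge-ENDS of colour `i` at vertex `v` (a self-loop contributes `2`).
[cite: CamiaJiangNewman2023, §3.1] -/
def degIn (G : MGraph nV nE) {q : ℕ} (c : Fin nE → Fin q) (i : Fin q) (v : Fin nV) : ℕ :=
  ((List.finRange nE).filter fun e => c e = i ∧ G.fst e = v).length +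
    ((List.finRange nE).filter fun e => c e = i ∧ G.snd e = v).length

/-- `v ∈ ∂Γ_{i}`: odd degree in the colour class `i`. [cite: CamiaJiangNewman2023, §3.1 eq. (26)] -/
def oddIn (G : MGraph nV nE) {q : ℕ} (c : Fin nE → Fin q) (i : Fin q) (v : Fin nV) : Bool :=
  degIn G c i v % 2 == 1

/-- The boundary `∂Γ_i` as a list of vertices. [cite: CamiaJiangNewman2023, §3.1 eq. (26)] -/
def bdList (G : MGraph nV nE) {q : ℕ} (c : Fin nE → Fin q) (i : Fin q) : List (Fin nV) :=
  (List.finRange nV).filter fun v => oddIn G c i v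

/-- Adjacency through edges whose colour satisfies `p`. [folklore] -/
def adjVia (G : MGraph nV nE) {q : ℕ} (c : Fin nE → Fin q) (p : Fin q → Bool) (v w : Fin nV) :
    Bool :=
  (List.finRange nE).any fun e =>
    p (c e) && ((G.fst e == v && G.snd e == w) || (G.fst e == w && G.snd e == v))

/-- One step of breadth-first closure of a vertex set. [folklore] -/
def expand (G : MGraph nV nE) {q : ℕ} (c : Fin nE → Fin q) (p : Fin q → Bool)
    (s : Fin nV → Bool) : Fin nV → Bool :=
  fun w => s w || (List.finRange nV).any fun x => s x && adjVia G c p x w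

/-- `m`-fold closure. [folklore] -/
def expandN (G : MGraph nV nE) {q : ℕ} (c : Fin nE → Fin q) (p : Fin q → Bool) :
    ℕ → (Fin nV → Bool) → (Fin nV → Bool)
  | 0, s => s
  | m + 1, s => expandN G c p m (expand G c p s)

/-- `v` and `w` are joined by a path using only edges of colours in `p` (closure iterated `nV`
times suffices on `nV` vertices). [folklore] -/
def connVia (G : MGraph nV nE) {q : ℕ} (c : Fin nE → Fin q) (p : Fin q → Bool) (v w : Fin nV) :
    Bool :=
  expandN G c p nV (fun x => x == v) w

/-- `l₁ ⊆ l₂` for lists of vertices. [folklore] -/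
def subsetB (l₁ l₂ : List (Fin nV)) : Bool := l₁.all fun v => l₂.any fun w => w == v

/-- Validity of an encoded partition `(c, n)` of `G` (`k+1` colours, `1 ≤ n ≤ k`): colours `< n-1`
are non-special blocks (boundary a nonempty subset of the sources `S`), colour `n-1` is the special
block (boundary `P ∪ {u₀,v₀}` with `∅ ≠ P ⊆ S`), colours `≥ n` are sourceless, the blocks are
pairwise disjoint and cover `S`, and `u₀ ↮ v₀` through colours `{n-1, n}`.  Assumes `u₀,v₀ ∉ S`.
[cite: CamiaJiangNewman2023, §3.1] -/
def valid (G : MGraph nV nE) (k : ℕ) (S : List (Fin nV)) (u₀ v₀ : Fin nV)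
    (c : Fin nE → Fin (k + 1)) (n : ℕ) : Bool :=
  let cols := List.finRange (k + 1)
  -- non-special blocks
  (cols.all fun i => !(i.val + 1 < n) ||
      (!(bdList G c i).isEmpty && subsetB (bdList G c i) S)) &&
  -- special block: u₀, v₀ odd, the rest a nonempty subset of S
  (cols.all fun i => !(i.val + 1 == n) ||
      (oddIn G c i u₀ && oddIn G c i v₀ &&
        !((bdList G c i).filter fun v => !(v == u₀) && !(v == v₀)).isEmpty &&
        subsetB ((bdList G c i).filter fun v => !(v == u₀) && !(v == v₀)) S)) &&
  -- sourceless classes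
  (cols.all fun i => !(n ≤ i.val) || (bdList G c i).isEmpty) &&
  -- every source lies in exactly one block (disjointness + cover)
  (S.all fun s => ((cols.filter fun i => i.val + 1 ≤ n ∧ oddIn G c i s).length == 1)) &&
  -- u₀ ↮ v₀ in Γ_n ∪ Γ_{n+1}
  !(connVia G c (fun i => i.val + 1 == n || i.val == n) u₀ v₀)

/-- All colourings `Fin nE → Fin (k+1)`, enumerated as base-`(k+1)` digit strings.
[folklore] -/
def coloring (k : ℕ) (N : ℕ) : Fin nE → Fin (k + 1) :=
  fun e => ⟨(N / (k + 1) ^ e.val) % (k + 1), Nat.mod_lt _ (Nat.succ_pos k)⟩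

/-- The restricted signed partition count
`R(G; {e,e'} ∈ diff, [e,e'] ∈ same) = Σ_{(c,n) valid, restrictions} (-1)^{n-1}`
(`diff`: the two edges in different subgraphs, CJN's `{e,e'}`; `same`: in the same subgraph,
CJN's `[e,e']`). [cite: CamiaJiangNewman2023, §3.2 eq. (29)–(30)] -/
def signedCount (G : MGraph nV nE) (k : ℕ) (S : List (Fin nV)) (u₀ v₀ : Fin nV)
    (diff same : List (Fin nE × Fin nE)) : ℤ :=
  ((List.range ((k + 1) ^ nE)).map fun N =>
    let c : Fin nE → Fin (k + 1) := coloring k N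
    if (diff.all fun p => !(c p.1 == c p.2)) && (same.all fun p => c p.1 == c p.2) then
      ((List.range k).map fun m => if valid G k S u₀ v₀ c (m + 1) then (-1 : ℤ) ^ m else 0).sum
    else 0).sum

/-! ### Instance 1 (k = 1): the contraction identity (31) fails -/

/-- `𝒢`: vertices `u₀ = 0, v₁ = 1, v = 2, v₂ = 3, v₀ = 4`; sources `S = {v, v₂}` (`k = 1`);
edges `e₀ = u₀v₁, e₁ = v₁v, e₂ = vv₂, e₃ = vv₀` (so `∂𝒢 = S ∪ {u₀,v₀}`). [folklore] -/
def G31 : MGraph 5 4 where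
  fst := ![0, 1, 2, 2]
  snd := ![1, 2, 3, 4]

/-- `𝒢~`: `𝒢` with `e₁ = v₁v, e₂ = vv₂` (two edges at `v ∉ {u₀,v₀}`) contracted to `e₁₂ = v₁v₂`
(CJN eq. (31) with `v = 2`): edges `u₀v₁, v₁v₂, vv₀`. [folklore] -/
def G31c : MGraph 5 3 where
  fst := ![0, 1, 2]
  snd := ![1, 3, 4]

/-- **Eq. (31) of CJN fails on this instance**: `R(𝒢; [e₁,e₂]) = 0` (indeed `𝒢` has no partition
at all: its only candidate, everything in `Γ₁`, joins `u₀` to `v₀`), whereas `R(𝒢~) = 1` (in `𝒢~`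
the unique partition has `u₀ ↮ v₀`).  CJN, §3.2 after (30): "Then it is obvious that
`R(𝒢;[e₁,e₂]) = R(𝒢~)`". [cite: CamiaJiangNewman2023, §3.2 eq. (31)] -/
theorem cjn_eq31_instance :
    signedCount G31 1 [2, 3] 0 4 [] [((1 : Fin 4), (2 : Fin 4))] = 0 ∧
      signedCount G31 1 [2, 3] 0 4 [] [] = 0 ∧
      signedCount G31c 1 [2, 3] 0 4 [] [] = 1 := by
  decide +kernel

/-! ### Instance 2 (k = 2): the restricted-sum claim (30) (Prop. 2) fails -/

/-- `𝒢`: sources `j₁..j₄ = 0,1,2,3`, `u₀ = 4`, `v₀ = 5` (`k = 2`, all distinct, `u₀,v₀ ∉ {j}`);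
edges `e₀ = j₂j₃ (1–2)`, `e₁ = j₃j₂ (2–1, parallel)`, `e₂ = u₀j₂ (4–1)`, `e₃ = v₀j₄ (5–3)`,
`e₄ = j₁j₃ (0–2)`; `∂𝒢 = {0,…,5} = {j} ∪ {u₀,v₀}`; no self-loops; no `u₀v₀`-edge.
(It is the multigraph of the current `m` with `m_{j₂j₃} = 2`, `m_{u₀j₂} = m_{v₀j₄} = m_{j₁j₃} = 1`
on any graph containing these edges and `u₀v₀`.) [folklore] -/
def G30 : MGraph 6 5 where
  fst := ![1, 2, 4, 5, 0]
  snd := ![2, 1, 1, 3, 2]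

/-- **Eq. (30) / Prop. 2 of CJN fails on this instance.**  With the list
`L = {e₀,e₂}, {e₀,e₄}, {e₁,e₄}` (pairs of edges adjacent at `j₂` resp. `j₃`; no self-loop, no
`u₀v₀`-edge, so (30) applies) the restricted count is `R(𝒢; L) = +1`, while `(-1)^{k-1} = -1`.
The three surviving encoded partitions are: `n=1` with `Γ₁ = {e₂,e₃,e₄}` and the parallel pair
`{e₀,e₁}` as `Γ₂` or as `Γ₃` (`+1` each), and `n=2` with `Γ₁ = {e₄}` (`∂ = {j₁,j₃}`),
`Γ₂ = {e₂,e₃}` (`∂ = {j₂,j₄,u₀,v₀}`), `Γ₃ = {e₀,e₁}` (`-1`).  The unrestricted count is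
`R(𝒢) = -4`, of the sign `(-1)^{k-1}` that Prop. 1 asserts. [cite: CamiaJiangNewman2023, Prop. 2 eq. (30)] -/
theorem cjn_eq30_instance :
    signedCount G30 2 [0, 1, 2, 3] 4 5
        [((0 : Fin 5), (2 : Fin 5)), ((0 : Fin 5), (4 : Fin 5)), ((1 : Fin 5), (4 : Fin 5))] [] = 1 ∧
      signedCount G30 2 [0, 1, 2, 3] 4 5 [] [] = -4 := by
  decide +kernel


/-! ### Instance 3 (k = 2): WHERE the induction of §3.2 leaves its hypothesis class

The reduction (32)–(33) of CJN §3.2 treats `R(𝒢; [e₁,e₂], L)` (the pair `e₁, e₂` forced into the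
same subgraph) as `R(𝒢~; L~)` for the contracted graph `𝒢~` of (31) with the list revised
(`e₁, e₂ ↦ e₁₂`), and then invokes the induction hypothesis (30) for `(𝒢~; L~)`.  But (30) is
stated only for lists containing no self-loop and no `u₀v₀`-edge, while the contraction of two
PARALLEL edges `e₁ = vv₁`, `e₂ = vv₁` is the self-loop `e₁₂ = v₁v₁` (CJN Remark 3: "e₁₂ … could
be a self-loop"), which enters `L~` whenever `e₁` or `e₂` was listed.  On Instance 2 this is exactly
what happens: splitting `R(𝒢; L)` at the parallel pair `{e₀,e₁}` (eq. (32)),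
`R(𝒢; L) = R(𝒢; [e₀,e₁], L) + R(𝒢; {e₀,e₁}, L) = 1 + 0`, and the first term is the restricted
count of the contracted graph `𝒢~` (a `𝒦^{II}_2` of Fig. 6 plus the self-loop `j₃j₃`) with the
self-loop paired in the list — the configuration of CJN Remark 3, of the wrong sign `+1`.  So the
surviving term of the induction is one to which (30) does not apply (and for which it is false). -/

/-- `𝒢~`: Instance 2 with the parallel pair `e₀ = j₂j₃`, `e₁ = j₃j₂` contracted at `j₂` (eq. (31)):
the self-loop `ℓ = j₃j₃ (2–2)`, `u₀j₂ (4–1)`, `v₀j₄ (5–3)`, `j₁j₃ (0–2)`.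
[cite: CamiaJiangNewman2023, §3.2 eq. (31) and Remark 3] -/
def G30c : MGraph 6 4 where
  fst := ![2, 4, 5, 0]
  snd := ![2, 1, 3, 2]

/-- **The §3.2 induction step on Instance 2.**  With `L = {e₀,e₂}, {e₀,e₄}, {e₁,e₄}` as in
`cjn_eq30_instance`: (i) `R(𝒢; [e₀,e₁], L) = 1` and `R(𝒢; {e₀,e₁}, L) = 0` (eq. (32) at the
parallel pair, summing to `R(𝒢; L) = 1`); (ii) the first term equals the restricted count
`R(𝒢~; {ℓ,u₀j₂}, {ℓ,j₁j₃}) = 1` of the contracted graph, whose list contains the self-loop `ℓ`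
(outside the scope of (30), sign `(-1)^{k-1}·1 = -1 < 0`), while `R(𝒢~) = 0` unrestricted
(`= 3·R(𝒦^{II}_2) = 0`, Lemma 6). [cite: CamiaJiangNewman2023, §3.2 eqs. (30)–(33), Remark 3, Lemma 6] -/
theorem cjn_eq32_instance :
    signedCount G30 2 [0, 1, 2, 3] 4 5
        [((0 : Fin 5), (2 : Fin 5)), ((0 : Fin 5), (4 : Fin 5)), ((1 : Fin 5), (4 : Fin 5))]
        [((0 : Fin 5), (1 : Fin 5))] = 1 ∧
      signedCount G30 2 [0, 1, 2, 3] 4 5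
        [((0 : Fin 5), (1 : Fin 5)), ((0 : Fin 5), (2 : Fin 5)), ((0 : Fin 5), (4 : Fin 5)),
          ((1 : Fin 5), (4 : Fin 5))] [] = 0 ∧
      signedCount G30c 2 [0, 1, 2, 3] 4 5 [((0 : Fin 4), (1 : Fin 4)), ((0 : Fin 4), (3 : Fin 4))] [] = 1 ∧
      signedCount G30c 2 [0, 1, 2, 3] 4 5 [] [] = 0 := by
  decide +kernel

/-! ### Instance 4: the template argument — Shlosman 1986, Theorem 3 — fails in the same way

CJN §3 "employ the combinatorial method introduced by Shlosman in [Shl86]".  Shlosman's own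
setting (CMP 102 (1986), §3) has `2k` sources, `k` subgraphs, no special block and no connectivity
condition: a partition of `G` (`#∂G = 2k`) is a sequence `Γ₁,…,Γ_k` of edge-disjoint spanning
subgraphs covering `B(G)` with `∂Γ_i ⊆ ∂G` and `{∂Γ_i}` a partition of `∂G`; distinctness as in
CJN (unordered on the nonempty boundaries, ordered tuple of the sourceless ones); `R(G) = Σ_𝒯
(-1)^{n(𝒯)-1}(n(𝒯)-1)!` (his (15)); Theorem 2: `(-1)^{k+1} R(G) ≥ 0`; Theorem 3 (the strengthened
induction hypothesis, "an arbitrary sequence of pairs of bonds", listed pairs in different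
subgraphs): `(-1)^{k+1} R(G; {b,b'},…) ≥ 0`.  Encoded as for CJN with `q+1 = k` colours (colours
`< n` the nonempty boundaries in any order, so a partition with `n` nonempty boundaries is `n!`
colourings and we return `k!·R = Σ_{(c,n) valid} (-1)^{n-1} k!/n ∈ ℤ`).

`shlosman_thm3_instance` (`k = 2`, a loop-free multigraph: the path `j₁j₂j₄j₃` with the middle
bond doubled, and three pairs of ADJACENT bonds): `2!·R(G) = -8` (the sign of Theorem 2) but
`2!·R(G; L) = +2`, i.e. `(-1)^{k+1}R(G;L) = -1 < 0`: Theorem 3 of [Shl86] is false as stated, by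
the same mechanism (his surgery (16)/(19) contracts parallel bonds into a loop that stays in the
list, and a loop alone in a subgraph contributes even degree, so the terminal case "#S(v) > 1 ⇒ no
allowed partition" of his proof does not cover it).  Theorem 2 of [Shl86] / Prop. 1 of CJN are NOT
refuted by this. -/

/-- Validity of an encoded Shlosman partition `(c, n)` (`q+1` colours, `1 ≤ n ≤ q+1`): colours `< n`
have nonempty boundary `⊆ S`, colours `≥ n` empty boundary, and every source lies in exactly one
boundary. [cite: Shlosman1986, §3 (definition of a partition, conditions 1)–3))] -/
def validShl (G : MGraph nV nE) (q : ℕ) (S : List (Fin nV)) (c : Fin nE → Fin (q + 1)) (n : ℕ) :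
    Bool :=
  let cols := List.finRange (q + 1)
  (cols.all fun i => !(i.val < n) || (!(bdList G c i).isEmpty && subsetB (bdList G c i) S)) &&
  (cols.all fun i => !(n ≤ i.val) || (bdList G c i).isEmpty) &&
  (S.all fun s => ((cols.filter fun i => i.val < n ∧ oddIn G c i s).length == 1))

/-- `k!·R(G; {e,e'} ∈ diff, [e,e'] ∈ same)` in Shlosman's setting with `k = q+1` subgraphs:
`Σ_{(c,n) valid, restrictions} (-1)^{n-1} k!/n`. [cite: Shlosman1986, §3 eq. (15), (17)–(18)] -/
def signedCountShl (G : MGraph nV nE) (q : ℕ) (S : List (Fin nV))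
    (diff same : List (Fin nE × Fin nE)) : ℤ :=
  ((List.range ((q + 1) ^ nE)).map fun N =>
    let c : Fin nE → Fin (q + 1) := coloring q N
    if (diff.all fun p => !(c p.1 == c p.2)) && (same.all fun p => c p.1 == c p.2) then
      ((List.range (q + 1)).map fun m =>
        if validShl G q S c (m + 1) then (-1 : ℤ) ^ m * (((q + 1).factorial / (m + 1) : ℕ) : ℤ)
        else 0).sum
    else 0).sum

/-- Shlosman's setting, `k = 2`: sources `j₁..j₄ = 0,1,2,3`; bonds `b₀ = j₂j₁ (1–0)`,
`b₁ = j₄j₂ (3–1)`, `b₂ = j₄j₃ (3–2)`, `b₃ = j₂j₄ (1–3)` (parallel to `b₁`); `∂G = {0,1,2,3}`, no loop.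
[folklore] -/
def GS3 : MGraph 4 4 where
  fst := ![1, 3, 3, 1]
  snd := ![0, 1, 2, 3]

/-- **Theorem 3 of [Shl86] fails on this instance.**  With the list of adjacent pairs
`L = {b₁,b₂}` (at `j₄`), `{b₀,b₁}`, `{b₀,b₃}` (at `j₂`): `2·R(G) = -8` (so `(-1)^{k+1}R(G) = 4 ≥ 0`,
Theorem 2 holds here) but `2·R(G; L) = 2`, i.e. `(-1)^{k+1} R(G;L) = -1 < 0` (the only surviving
partition is `Γ₁ = {b₀,b₂}` (`∂ = ∂G`), `Γ₂ = {b₁,b₃}` (`∂ = ∅`), `n = 1`).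
[cite: Shlosman1986, Thm 3, eq. (18)] -/
theorem shlosman_thm3_instance :
    signedCountShl GS3 1 [0, 1, 2, 3] [] [] = -8 ∧
      signedCountShl GS3 1 [0, 1, 2, 3]
        [((1 : Fin 4), (2 : Fin 4)), ((0 : Fin 4), (1 : Fin 4)), ((0 : Fin 4), (3 : Fin 4))] [] = 2 := by
  decide +kernel

end CJNPartitionCount

/-! ### Instances 5–6: Shlosman's Theorem 3 — the failing node is produced by his own recursion,
### and parallel bonds are not needed

A second, independent encoding of Shlosman's count (namespace `ShlosmanPartitionCount`): blocks
listed in the CANONICAL order of increasing smallest vertex, so that each partition of [Shl86] §3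
is exactly one valid `(c, n)` and the weight is his `(-1)^{n-1}(n-1)!` verbatim (no `k!`
normalisation); cross-validated against an independent enumeration on 18 random instances
(`k = 2, 3`).  Two further certified facts about Theorem 3 of [Shl86]:

* `shlosman_thm3_recursion_path` (`k = 2`, the multigraph of Instance 4 up to relabelling: bonds
  `e₀ = e₁ = {0,1}`, `e₂ = {0,2}`, `e₃ = {1,3}`): the wrong-signed node
  `R(G; {e₀,e₂},{e₀,e₃},{e₁,e₂}) = +1` is REACHED from `R(G) = -4` by his recursion (17)/(19)
  (split at vertex `0` on `(e₀,e₂)`, then at `1` on `(e₀,e₃)`, then at `0` on `(e₁,e₂)`; every pair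
  unlisted, adjacent, loop-free, at a vertex with `#S(v) = 3`), all seven values along the path
  certified: `-4 = (-2) + (-2)`, `-2 = (-2) + 0`, `0 = (-1) + (+1)`.  So the false statement (18)
  is invoked by the printed proof of Theorem 2 on an actual branch, not merely stated too generally.
* `shlosman_thm3_simple_instance`: the same failure on a SIMPLE graph (triangle `0,1,2` with
  pendant edges `03`, `14`, `∂G = {0,1,3,4}`, list `{01,03},{01,14},{02,03}` of adjacent pairs):
  `R(G;L) = +1`, `R(G) = -4` — parallel bonds in `G` are not needed (they arise inside the
  recursion, when `01` and `02` are merged at `0` into a second copy of `12`). -/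


namespace ShlosmanPartitionCount

open CJNPartitionCount

variable {nV nE : ℕ}

/-- Smallest vertex index occurring in a list of vertices (`nV` for the empty list). [folklore] -/
def minV (l : List (Fin nV)) : ℕ := l.foldr (fun v m => min v.val m) nV

/-- Validity of an encoded partition `(c, n)` of `G` in SHLOSMAN's sense (§3, conditions 1)–3)):
`q+1` subgraphs `Γ_1,…,Γ_{q+1}` (edge `e` lies in `Γ_{c(e)+1}`), the first `n` of which have
nonempty boundary contained in `X = ∂G` ("blocks"), the others empty boundary, every `x ∈ X` lying
in exactly one block; distinctness A)–C) (blocks as an UNORDERED family, the boundary-free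
subgraphs as an ordered tuple) is implemented by listing the blocks in the canonical order of
strictly increasing smallest vertex, so that each partition is exactly one valid `(c, n)`.
[cite: Shlosman1986, §3 (definition of a partition, conditions A)–C))] -/
def validS (G : MGraph nV nE) {q : ℕ} (X : List (Fin nV)) (c : Fin nE → Fin (q + 1)) (n : ℕ) :
    Bool :=
  let cols := List.finRange (q + 1)
  -- blocks: nonempty boundary inside X
  (cols.all fun i => !(i.val < n) || (!(bdList G c i).isEmpty && subsetB (bdList G c i) X)) &&
  -- boundary-free subgraphs
  (cols.all fun i => !(n ≤ i.val) || (bdList G c i).isEmpty) &&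
  -- every boundary vertex lies in exactly one block
  (X.all fun x => ((cols.filter fun i => i.val < n ∧ oddIn G c i x).length == 1)) &&
  -- canonical order of the blocks
  (cols.all fun i => cols.all fun j =>
    !(i.val < j.val ∧ j.val < n) || decide (minV (bdList G c i) < minV (bdList G c j)))

/-- Shlosman's restricted signed count over partitions of `G` into `q+1` subgraphs,
`R(G; {b,b'} ∈ diff, [b,b'] ∈ same) = Σ_𝒯 (-1)^{n(𝒯)-1} (n(𝒯)-1)!`, the sum restricted to
partitions with each `diff` pair in different subgraphs and each `same` pair in the same subgraph
(his `R(G;{b_{i₁},b_{j₁}},…)` and `R(G;[b₁,b₂])`). [cite: Shlosman1986, §3 eq. (15), (17)–(19)] -/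
def signedCountS (G : MGraph nV nE) (q : ℕ) (X : List (Fin nV))
    (diff same : List (Fin nE × Fin nE)) : ℤ :=
  ((List.range ((q + 1) ^ nE)).map fun N =>
    let c : Fin nE → Fin (q + 1) := coloring q N
    if (diff.all fun p => !(c p.1 == c p.2)) && (same.all fun p => c p.1 == c p.2) then
      ((List.range (q + 1)).map fun m =>
        if validS G X c (m + 1) then (-1 : ℤ) ^ m * (Nat.factorial m : ℤ) else 0).sum
    else 0).sum

/-- Shlosman's instance: vertices `0,1,2,3`, all of them in `∂G` (`k = 2` subgraphs); bonds
`e₀ = {0,1}`, `e₁ = {0,1}` (parallel), `e₂ = {0,2}`, `e₃ = {1,3}`; no self-loop, no vertex of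
degree two. [folklore] -/
def GS : MGraph 4 4 where
  fst := ![0, 0, 0, 1]
  snd := ![1, 1, 2, 3]

/-- **Theorem 3 of [Shlosman1986] fails at a node of his own recursion (17)/(19).**
With `k = 2` (so the asserted sign of every restricted count is `(-1)^{k+1} = -1`):
`R(G) = -4`; splitting at vertex `0` on `(e₀,e₂)`: `R(G;[e₀,e₂]) = -2`, `R(G;{e₀,e₂}) = -2`;
splitting the latter at vertex `1` on `(e₀,e₃)`: `R(G;[e₀,e₃];{e₀,e₂}) = -2`,
`R(G;{e₀,e₂},{e₀,e₃}) = 0`; splitting the latter at vertex `0` on `(e₁,e₂)`: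
`R(G;[e₁,e₂];{e₀,e₂},{e₀,e₃}) = -1` but `R(G;{e₀,e₂},{e₀,e₃},{e₁,e₂}) = +1 > 0`, contradicting
eq. (18).  (The unique partition of `G` compatible with the last list: `Γ₁ = {e₂,e₃}` with
`∂Γ₁ = {0,1,2,3}`, `n(𝒯) = 1`, and the boundary-free `Γ₂ = {e₀,e₁}`, of weight `+1`.  Continuing
his recursion from this node, the unlisted adjacent pairs are `(e₁,e₃)` (listing it changes
nothing: the count stays `+1`) and the parallel pair `(e₀,e₁)`, whose listing gives `0` and whose
merging by the surgery of Fig. 1 produces a self-loop at a boundary vertex occurring twice in the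
revised list — a configuration covered neither by the loop rule `R(G) = kR(G∖b)` (unrestricted
counts only) nor by the degree-two rule.)
[cite: Shlosman1986, Theorem 3, eq. (17)–(19)] -/
theorem shlosman_thm3_recursion_path :
    signedCountS GS 1 [0, 1, 2, 3] [] [] = -4 ∧
      signedCountS GS 1 [0, 1, 2, 3] [] [((0 : Fin 4), (2 : Fin 4))] = -2 ∧
      signedCountS GS 1 [0, 1, 2, 3] [((0 : Fin 4), (2 : Fin 4))] [] = -2 ∧
      signedCountS GS 1 [0, 1, 2, 3] [((0 : Fin 4), (2 : Fin 4))] [((0 : Fin 4), (3 : Fin 4))] = -2 ∧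
      signedCountS GS 1 [0, 1, 2, 3] [((0 : Fin 4), (2 : Fin 4)), ((0 : Fin 4), (3 : Fin 4))] [] = 0 ∧
      signedCountS GS 1 [0, 1, 2, 3] [((0 : Fin 4), (2 : Fin 4)), ((0 : Fin 4), (3 : Fin 4))]
        [((1 : Fin 4), (2 : Fin 4))] = -1 ∧
      signedCountS GS 1 [0, 1, 2, 3]
        [((0 : Fin 4), (2 : Fin 4)), ((0 : Fin 4), (3 : Fin 4)), ((1 : Fin 4), (2 : Fin 4))] [] = 1 := by
  decide +kernel

/-- The same phenomenon on a SIMPLE graph: triangle `0,1,2` with pendant edges `03` and `14`;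
`∂G = {0,1,3,4}` (`k = 2`); bonds `e₀ = 01, e₁ = 02, e₂ = 03, e₃ = 12, e₄ = 14`. [folklore] -/
def GS' : MGraph 5 5 where
  fst := ![0, 0, 0, 1, 1]
  snd := ![1, 2, 3, 2, 4]

/-- **Theorem 3 of [Shlosman1986] fails on a simple graph**: for the list of adjacent pairs
`{e₀,e₂}, {e₀,e₄}, {e₁,e₂}` the restricted count is `+1` (the only surviving partition is
`Γ₁ = {e₂,e₄}` (`∂ = {0,1,3,4}`), `Γ₂ =` the triangle), while `k = 2` demands `≤ 0`; the
unrestricted count is `R(G) = -4`. [cite: Shlosman1986, Theorem 3] -/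
theorem shlosman_thm3_simple_instance :
    signedCountS GS' 1 [0, 1, 3, 4]
        [((0 : Fin 5), (2 : Fin 5)), ((0 : Fin 5), (4 : Fin 5)), ((1 : Fin 5), (2 : Fin 5))] [] = 1 ∧
      signedCountS GS' 1 [0, 1, 3, 4] [] [] = -4 := by
  decide +kernel

end ShlosmanPartitionCount

end Literature.Probability.LatticeModels
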